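import Summits.CriticalPhenomena.SAWScalingLimit.Theorems.ConfinementPositivity.Negative.LoadBearing
import Literature.Probability.RandomPlanarGeometry.TriangleDomain

/-!
# `ConfinementPositivity` (stmt-CriticalPhenomena-17587) — negative knowledge: nesting is load-bearing

Refuter crux-attack support file (cdisprove) for the crux
`Summit.CriticalPhenomena.SAWScalingLimit.Theses.SAWRenewalTightness.ConfinementPositivity`,
continuing `Negative/LoadBearing.lean` (which records `diag`, `nonVacuous`,
`false_without_endpointApprox`, `not_uniformThreshold`).

* `false_without_nested` — dropping the nesting hypothesis `D'.carrier ⊆ D.carrier` makes the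
  statement FALSE, all other hypotheses kept verbatim (same marked points, sockets, an honest
  endpoint approximation of `D'`).  Witness: `D' = (𝔻; 1, -1)` with the honest real-axis
  approximation `a_δ = (⌈δ⁻¹⌉ - 1, 0)`, `b_δ = -a_δ` (`isEndpointApprox_std`), and `D = (Δ; 1, -1)`
  the open INSCRIBED triangle with apex `i` (`exists_triUp`): `Δ ⊆ 𝔻` (so the socket condition holds
  trivially), `Δ` and `𝔻` have the same marked points `1, -1`, but `Δ` lies in the open upper
  half plane, so the real lattice point `a_δ` is never a vertex of `Δ_δ` and the critical SAW law
  of `Δ_δ` from `a_δ` is the junk measure `0` at EVERY mesh: no `c > 0` works.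
  Moral for provers: the endpoint approximation is tied to `D'`, and only nesting (with
  `JordanDomain.exists_forall_meshDomain_subset`) transfers it to `D`; the proof must use
  `D'.carrier ⊆ D.carrier` at least through `D'_δ ⊆ D_δ` eventually.

Written on the VERBATIM body of the crux with one hypothesis deleted; no positive Theses
conclusion is asserted. Everything proved, standard axioms. [folklore]
-/

noncomputable section

namespace Summit.CriticalPhenomena.SAWScalingLimit.Theorems.ConfinementPositivity.Negative

open MeasureTheory Set Metric Filter Topology
open Literature.Probability.RandomPlanarGeometry Literature.Probability.LatticeModels
open Summit.CriticalPhenomena.SAWScalingLimit.Theorems.SubseqIdentification.Negative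

/-! ### The inscribed triangle `(Δ; 1, -1)` with apex `i` -/

/-- The triangle `1, -1, i` is non-degenerate. [folklore] -/
theorem affineIndependent_triUp : AffineIndependent ℝ ![(1 : ℂ), -1, Complex.I] := by
  rw [affineIndependent_iff_not_collinear_set]
  intro hcol
  rw [collinear_iff_of_mem (p₀ := (1 : ℂ)) (by simp)] at hcol
  obtain ⟨v, hv⟩ := hcol
  obtain ⟨r₁, hr₁⟩ := hv (-1) (by simp)
  obtain ⟨r₂, hr₂⟩ := hv Complex.I (by simp)
  simp only [vadd_eq_add] at hr₁ hr₂
  have h1 := congrArg Complex.re hr₁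
  have h2 := congrArg Complex.im hr₁
  have h3 := congrArg Complex.re hr₂
  have h4 := congrArg Complex.im hr₂
  simp only [Complex.add_re, Complex.add_im, Complex.smul_re, Complex.smul_im, smul_eq_mul,
    Complex.neg_re, Complex.neg_im, Complex.one_re, Complex.one_im, Complex.I_re,
    Complex.I_im, neg_zero] at h1 h2 h3 h4
  -- -1 = r₁ v.re + 1, 0 = r₁ v.im, 0 = r₂ v.re + 1, 1 = r₂ v.im
  have : r₁ * v.im * (r₂ * v.re) = r₂ * v.im * (r₁ * v.re) := by ring
  nlinarith

/-- The closed triangle `1, -1, i` lies in the closed unit disc. [folklore] -/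
theorem convexHull_triUp_subset_closedBall :
    convexHull ℝ {(1 : ℂ), -1, Complex.I} ⊆ Metric.closedBall (0 : ℂ) 1 := by
  refine convexHull_min ?_ (convex_closedBall (0 : ℂ) 1)
  intro z hz
  simp only [mem_insert_iff, mem_singleton_iff] at hz
  rcases hz with rfl | rfl | rfl <;> simp

/-- The closed triangle `1, -1, i` lies in the closed upper half plane. [folklore] -/
theorem convexHull_triUp_subset_im_nonneg :
    convexHull ℝ {(1 : ℂ), -1, Complex.I} ⊆ {z : ℂ | 0 ≤ z.im} := by
  refine convexHull_min ?_ ((convex_Ici (0 : ℝ)).linear_preimage Complex.imLm)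
  intro z hz
  simp only [mem_insert_iff, mem_singleton_iff] at hz
  rcases hz with rfl | rfl | rfl <;> simp

/-- **The inscribed triangle** `(Δ; 1, -1)` (open solid triangle with vertices `1, -1, i`,
marked at `1` and `-1`: Carleson's rectangle on `Δ(1, -1, i)` with the first two marks kept)
exists as a Dobrushin domain with: marked points `1, -1`; `Δ ⊆ 𝔻` (INSCRIBED); `Δ` inside the
OPEN upper half plane.  Packaged existentially (no new definition in `Theorems/`). [folklore] -/
theorem exists_triUp : ∃ D : DobrushinDomain, D.pt 0 = 1 ∧ D.pt 1 = -1 ∧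
    D.carrier ⊆ Metric.ball (0 : ℂ) 1 ∧ D.carrier ⊆ {z : ℂ | 0 < z.im} := by
  refine ⟨(triangleRectangle 1 (-1) Complex.I affineIndependent_triUp (1 / 2)
    ⟨by norm_num, by norm_num⟩).chord 0 1 (by decide), ?_, ?_, ?_, ?_⟩
  · rw [MarkedDomain.pt_chord_zero]
    exact (triangleRectangle_pt affineIndependent_triUp _).1
  · rw [MarkedDomain.pt_chord_one]
    exact (triangleRectangle_pt affineIndependent_triUp _).2.1
  · show interior (convexHull ℝ {(1 : ℂ), -1, Complex.I}) ⊆ Metric.ball (0 : ℂ) 1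
    rw [← interior_closedBall (0 : ℂ) one_ne_zero]
    exact interior_mono convexHull_triUp_subset_closedBall
  · show interior (convexHull ℝ {(1 : ℂ), -1, Complex.I}) ⊆ {z : ℂ | 0 < z.im}
    rw [← Complex.interior_setOf_le_im (0 : ℝ)]
    exact interior_mono convexHull_triUp_subset_im_nonneg

/-- The honest real-axis endpoint `a_δ = (⌈δ⁻¹⌉ - 1, 0)` of the disc is never a vertex of the
discretisation of a domain lying in the open upper half plane (its mesh point is real).
[folklore] -/
theorem stdA_not_mem_meshDomain_of_subset {Ω : Set ℂ} (hΩ : Ω ⊆ {z : ℂ | 0 < z.im}) (δ : ℝ) :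
    (![⌈δ⁻¹⌉ - 1, 0] : Site 2) ∉ meshDomain Ω δ := by
  intro hmem
  have hv := meshDomain_subset_meshVertices _ _ hmem
  rw [mem_meshVertices_iff] at hv
  have him := hΩ hv
  simp only [mem_setOf_eq, meshPoint_im] at him
  simp at him

/-- The two honest endpoints are distinct as soon as `δ < 1`. [folklore] -/
theorem stdA_ne_stdB {δ : ℝ} (hδ : 0 < δ) (hδ1 : δ < 1) :
    (![⌈δ⁻¹⌉ - 1, 0] : Site 2) ≠ ![-(⌈δ⁻¹⌉ - 1), 0] := by
  intro h
  have h0 := congrFun h 0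
  simp only [Matrix.cons_val_zero] at h0
  have hceil : (1 : ℤ) < ⌈δ⁻¹⌉ := by
    rw [Int.lt_ceil]
    push_cast
    exact one_lt_inv₀ hδ |>.2 hδ1
  omega

/-- **Nesting is load-bearing.** The crux WITHOUT the hypothesis `D'.carrier ⊆ D.carrier` is
FALSE (all other hypotheses verbatim): witness `D = (Δ; 1, -1)` (inscribed triangle, apex `i`),
`D' = (𝔻; 1, -1)`, `d = 1`, the honest real-axis approximation of `D'`; the SAW law of `Δ_δ`
from the real point `a_δ ∉ Δ_δ` is the zero measure at every mesh `δ < 1`. [folklore] -/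
theorem false_without_nested :
    ¬ ∀ (D D' : DobrushinDomain) (a b : ℝ → Site 2) (d : ℝ), 0 < d →
      D'.pt 0 = D.pt 0 → D'.pt 1 = D.pt 1 →
      D.carrier ∩ (Metric.ball (D.pt 0) d ∪ Metric.ball (D.pt 1) d) ⊆ D'.carrier →
      SAW.IsEndpointApprox D' a b →
      ∃ c δ₀ : ℝ, 0 < c ∧ 0 < δ₀ ∧ ∀ δ ∈ Set.Ioc (0 : ℝ) δ₀,
        ENNReal.ofReal c ≤ SAW.law D.carrier δ (a δ) (b δ)
          {γ | ∃ γ' : SAW.DomainSAW D'.carrier δ (a δ) (b δ), γ'.walk.support = γ.walk.support} := by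
  intro h
  obtain ⟨D, hD0, hD1, hDball, hDim⟩ := exists_triUp
  have hsock : D.carrier ∩ (Metric.ball (D.pt 0) 1 ∪ Metric.ball (D.pt 1) 1) ⊆
      DobrushinDomain.unitDisc.carrier :=
    fun z hz => hDball hz.1
  obtain ⟨c, δ₀, hc, hδ₀, hall⟩ := h D DobrushinDomain.unitDisc
    (fun δ => ![⌈δ⁻¹⌉ - 1, 0]) (fun δ => ![-(⌈δ⁻¹⌉ - 1), 0]) 1 one_pos
    (by rw [unitDisc_pt.1, hD0]) (by rw [unitDisc_pt.2, hD1]) hsock isEndpointApprox_std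
  set δ := min δ₀ (1 / 2) with hδdef
  have hδpos : 0 < δ := lt_min hδ₀ (by norm_num)
  have hδ1 : δ < 1 := (min_le_right _ _).trans_lt (by norm_num)
  have hmain := hall δ ⟨hδpos, min_le_left _ _⟩
  rw [law_eq_zero (stdA_not_mem_meshDomain_of_subset hDim δ) (stdA_ne_stdB hδpos hδ1),
    Measure.coe_zero, Pi.zero_apply, nonpos_iff_eq_zero, ENNReal.ofReal_eq_zero] at hmain
  linarith

end Summit.CriticalPhenomena.SAWScalingLimit.Theorems.ConfinementPositivity.Negative

end
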